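import Summits.CriticalPhenomena.SAWScalingLimit.Theorems.SAWDevelopingMapInteriorFlatteningLiouvilleDefs
import Summits.CriticalPhenomena.SAWScalingLimit.Theorems.SAWDevelopingMapInteriorFlatteningLiouvilleHarnackChains

/-!
# Lattice Harnack chains for the line `liouville-local-limits` (crux `InteriorFlattening`, stmt-CriticalPhenomena-8297)

Lead `prover-line-stmt-CriticalPhenomena-8297-c1-0`; worker of the slot `stub_intrusionTail` (S6').
This is the Liouville-side wrapper of `…LiouvilleHarnackChains.lean` over the objects of the Defs
module `…LiouvilleDefs` (`obs`, `omega`, `fieldMono`, `fieldBelt`, `Deep`, `RatioAtDepth`, `O`,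
`nbA`, `nbB`, `nbC`, `obsMono`, `latticeBall`, `innerEdges`, `picField`, `picMono`), i.e. the API
the stubs `stub_compactnessAtOrigin` (S2) and `stub_uniquenessReduction` (S7) consume. TOOL, not a
closure: the bulk no-fold bound `RatioAtDepth R₀ k` (`0 ≤ k < 1`, stub S1) is a HYPOTHESIS everywhere.

* bridges: `obs = OneMouth.Fobs`, `fieldBelt (obs Λ a) = OneMouth.bel Λ a`,
  `fieldMono (obs Λ a) = OneMouth.mono Λ a`, `obsMono Λ a = OneMouth.mono Λ a O nbA nbB nbC`,
  `Deep = OneMouth.Deep` all hold by `rfl` (same bodies) and are used silently;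
  `depthFlat_of_ratioAtDepth` bundles the frame hypotheses (`RatioAtDepth R η → OneMouth.DepthFlat R η`);
  `isStar_O` (the canonical frame `(A, B, C)` of `O` is a labelled star), `star_mem_edgeSet`;
* (a) `harnack_vertex`, `harnack_vertex_ratio` — one-vertex lattice Harnack for ANY lattice field
  `G` (inverse `ℤ/3`-DFT; the skeleton's `noFoldHarnack`);
* (b) `obs_star_bounds`, `norm_obs_le_of_adj`, `fieldMono_obs_eq_zero_iff`,
  `fieldMono_obs_eq_zero_of_obs_eq_zero` — the observable at an `R₀`-deep vertex: the three edge
  moduli are pinched between `(1-k)/3 ‖M‖` and `(1+k)/3 ‖M‖`, pairwise comparable with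
  `K = (1+k)/(1-k)`, and `M = 0 ↔` the star vanishes `↔` one edge vanishes (DCS Lemma 1 in
  mode form — the `ω`-combination of the observable vanishes at one of the two labellings of every
  star — is used through `Harnack.star_bounds`; as a standalone statement over the Defs objects it
  is `BulkNoFold.fieldBelt_obs_eq_zero_or` of `…LiouvilleBulkNoFold.lean`);
* (c) `obs_le_of_deep` (registered sub-goal), `obsMono_le` — for every edge `z`, constants `C, N`
  (depending on `z, k, R₀` only) with `‖obs Λ a z‖ ≤ C ‖obsMono Λ a‖` and
  `‖obsMono Λ a‖ ≤ C ‖obs Λ a z‖` once `O` is `N`-deep ("alive or dead": `obs_eq_zero_iff`);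
  `obs_bounds_of_deep` (explicit `N = dist(c_v, c_O) + max R₀ 0`), and the versions UNIFORM over
  the comparison set `innerEdges r` (`obs_le_of_deep_inner`, `obsMono_le_inner`,
  `obs_eq_zero_iff_inner`), with their picture-domain instances (`picField_le_inner`,
  `picMono_le_inner`).

Sources: H. Duminil-Copin, S. Smirnov, Ann. of Math. 175 (2012) 1653–1665 (arXiv:1007.0575),
Lemma 1; line card `Cruxes/InteriorFlattening/Lines/liouville-local-limits.md`. Axioms `propext`,
`Classical.choice`, `Quot.sound` only.
-/

noncomputable section

open scoped BigOperators
open Literature.Probability.LatticeModels Literature.Probability.RandomPlanarGeometry.SAW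

namespace Summit.CriticalPhenomena.SAWScalingLimit.Theorems.InteriorFlattening.Liouville.Harnack

/-! ### Bridges to the `OneMouth` objects -/

/-- `RatioAtDepth R η` gives `OneMouth.DepthFlat R η` (same bodies — `obs`/`OneMouth.Fobs`,
`fieldBelt (obs Λ a)`/`OneMouth.bel Λ a`, `fieldMono (obs Λ a)`/`OneMouth.mono Λ a`,
`Deep`/`OneMouth.Deep` are definitionally equal — with the six frame hypotheses bundled as
`OneMouth.IsStar`; the converse is equally immediate and not needed here). -/
theorem depthFlat_of_ratioAtDepth {R η : ℝ} (h : RatioAtDepth R η) : OneMouth.DepthFlat R η := by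
  intro Λ hΛ a ha v hv hd w₀ w₁ w₂ hs
  obtain ⟨h₀, h₁, h₂, h01, h12, h02⟩ := hs
  exact h Λ hΛ a ha v hv hd w₀ w₁ w₂ h₀ h₁ h₂ h01 h12 h02

/-- **The canonical frame `(A, B, C)` of `O` is a labelled star**: `O ∼ A, B, C` (the up face of
the cell `0` is adjacent to the down faces of the cells `0, -e₀, -e₁`) and `A, B, C` are pairwise
distinct (compare cell coordinates). -/
theorem isStar_O : OneMouth.IsStar O nbA nbB nbC := by
  refine ⟨(hexGraph_adj_iff_of_snd_eq_zero_holds 0 0).2 (Or.inl rfl),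
    (hexGraph_adj_iff_of_snd_eq_zero_holds 0 _).2 (Or.inr (Or.inl (zero_sub _).symm)),
    (hexGraph_adj_iff_of_snd_eq_zero_holds 0 _).2 (Or.inr (Or.inr (zero_sub _).symm)),
    fun h => ?_, fun h => ?_, fun h => ?_⟩
  · simpa using congrFun (Prod.mk.inj h).1 0
  · simpa using congrFun (Prod.mk.inj h).1 0
  · simpa using congrFun (Prod.mk.inj h).1 1

/-- The three star edges of `O` are edges of the honeycomb lattice. -/
theorem star_mem_edgeSet :
    s(O, nbA) ∈ hexGraph.edgeSet ∧ s(O, nbB) ∈ hexGraph.edgeSet ∧ s(O, nbC) ∈ hexGraph.edgeSet :=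
  ⟨(SimpleGraph.mem_edgeSet _).2 isStar_O.1, (SimpleGraph.mem_edgeSet _).2 isStar_O.2.1,
    (SimpleGraph.mem_edgeSet _).2 isStar_O.2.2.1⟩

/-! ### (a) One vertex, any lattice field -/

/-- **Lattice Harnack at one vertex, for any lattice field `G`.** If the counter-clockwise
combination vanishes, `G{v,w₀} + ω² G{v,w₁} + ω G{v,w₂} = 0`, and
`‖fieldBelt G v w₀ w₁ w₂‖ ≤ k ‖fieldMono G v w₀ w₁ w₂‖`, then each of the three moduli is pinched:
`(1-k)‖fieldMono‖ ≤ 3‖G{v,wᵢ}‖ ≤ (1+k)‖fieldMono‖` (inverse `ℤ/3`-DFT: `3F₀ = M + B`,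
`3F₁ = M + ω²B`, `3F₂ = M + ωB`). -/
theorem harnack_vertex {k : ℝ} (G : Sym2 HexVertex → ℂ) (v w₀ w₁ w₂ : HexVertex)
    (hD : G s(v, w₀) + omega ^ 2 * G s(v, w₁) + omega * G s(v, w₂) = 0)
    (hB : ‖fieldBelt G v w₀ w₁ w₂‖ ≤ k * ‖fieldMono G v w₀ w₁ w₂‖) :
    ((1 - k) * ‖fieldMono G v w₀ w₁ w₂‖ ≤ 3 * ‖G s(v, w₀)‖ ∧
      3 * ‖G s(v, w₀)‖ ≤ (1 + k) * ‖fieldMono G v w₀ w₁ w₂‖) ∧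
    ((1 - k) * ‖fieldMono G v w₀ w₁ w₂‖ ≤ 3 * ‖G s(v, w₁)‖ ∧
      3 * ‖G s(v, w₁)‖ ≤ (1 + k) * ‖fieldMono G v w₀ w₁ w₂‖) ∧
    ((1 - k) * ‖fieldMono G v w₀ w₁ w₂‖ ≤ 3 * ‖G s(v, w₂)‖ ∧
      3 * ‖G s(v, w₂)‖ ≤ (1 + k) * ‖fieldMono G v w₀ w₁ w₂‖) :=
  modes_bounds hD hB

/-- **The skeleton's `noFoldHarnack`**: under the same hypotheses and `0 ≤ k < 1`, adjacent
mid-edge moduli compare with the quasiconformal constant `K = (1+k)/(1-k)`: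
`‖G{v,w₀}‖ ≤ K ‖G{v,w₁}‖`. -/
theorem harnack_vertex_ratio {k : ℝ} (hk0 : 0 ≤ k) (hk1 : k < 1) (G : Sym2 HexVertex → ℂ)
    (v w₀ w₁ w₂ : HexVertex) (hD : G s(v, w₀) + omega ^ 2 * G s(v, w₁) + omega * G s(v, w₂) = 0)
    (hB : ‖fieldBelt G v w₀ w₁ w₂‖ ≤ k * ‖fieldMono G v w₀ w₁ w₂‖) :
    ‖G s(v, w₀)‖ ≤ (1 + k) / (1 - k) * ‖G s(v, w₁)‖ := by
  obtain ⟨⟨-, hA⟩, ⟨hBf, -⟩, -⟩ := harnack_vertex G v w₀ w₁ w₂ hD hB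
  have h1k : 0 < 1 - k := by linarith
  have step1 : 3 * ‖G s(v, w₀)‖ * (1 - k) ≤ (1 + k) * ‖fieldMono G v w₀ w₁ w₂‖ * (1 - k) :=
    mul_le_mul_of_nonneg_right hA h1k.le
  have step2 : (1 + k) * ((1 - k) * ‖fieldMono G v w₀ w₁ w₂‖) ≤ (1 + k) * (3 * ‖G s(v, w₁)‖) :=
    mul_le_mul_of_nonneg_left hBf (by linarith)
  rw [div_mul_eq_mul_div, le_div_iff₀ h1k]
  nlinarith [step1, step2]

/-! ### (b) The observable at a deep vertex -/

/-- **Star bounds for the observable.** Under `RatioAtDepth R₀ k`, at an `R₀`-deep vertex `v ∈ Λ`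
(`Λ` simply connected, `a ∈ ∂Λ`) and for every frame:
`(1-k)‖M‖ ≤ 3‖F{v,wᵢ}‖ ≤ (1+k)‖M‖`, `M = fieldMono (obs Λ a) v w₀ w₁ w₂` (DCS Lemma 1 at the
counter-clockwise labelling + no-fold at the clockwise one + `harnack_vertex`). -/
theorem obs_star_bounds {k R₀ : ℝ} (hR : RatioAtDepth R₀ k) {Λ : Finset HexVertex}
    {a : Sym2 HexVertex} (hΛ : hexDomainSimplyConnected Λ) (ha : a ∈ hexDomainBoundary Λ)
    {v : HexVertex} (hv : v ∈ Λ) (hd : Deep Λ v R₀) {w₀ w₁ w₂ : HexVertex}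
    (h₀ : hexGraph.Adj v w₀) (h₁ : hexGraph.Adj v w₁) (h₂ : hexGraph.Adj v w₂) (h01 : w₀ ≠ w₁)
    (h12 : w₁ ≠ w₂) (h02 : w₀ ≠ w₂) :
    ((1 - k) * ‖fieldMono (obs Λ a) v w₀ w₁ w₂‖ ≤ 3 * ‖obs Λ a s(v, w₀)‖ ∧
      3 * ‖obs Λ a s(v, w₀)‖ ≤ (1 + k) * ‖fieldMono (obs Λ a) v w₀ w₁ w₂‖) ∧
    ((1 - k) * ‖fieldMono (obs Λ a) v w₀ w₁ w₂‖ ≤ 3 * ‖obs Λ a s(v, w₁)‖ ∧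
      3 * ‖obs Λ a s(v, w₁)‖ ≤ (1 + k) * ‖fieldMono (obs Λ a) v w₀ w₁ w₂‖) ∧
    ((1 - k) * ‖fieldMono (obs Λ a) v w₀ w₁ w₂‖ ≤ 3 * ‖obs Λ a s(v, w₂)‖ ∧
      3 * ‖obs Λ a s(v, w₂)‖ ≤ (1 + k) * ‖fieldMono (obs Λ a) v w₀ w₁ w₂‖) :=
  star_bounds (depthFlat_of_ratioAtDepth hR) hΛ ha hv hd ⟨h₀, h₁, h₂, h01, h12, h02⟩

/-- **Comparability of the three edges at a deep vertex**: `‖F{v,w}‖ ≤ K ‖F{v,w'}‖`,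
`K = (1+k)/(1-k)`, for any two neighbours `w, w'` of an `R₀`-deep `v ∈ Λ` (`0 ≤ k < 1`). -/
theorem norm_obs_le_of_adj {k R₀ : ℝ} (hk0 : 0 ≤ k) (hk1 : k < 1) (hR : RatioAtDepth R₀ k)
    {Λ : Finset HexVertex} {a : Sym2 HexVertex} (hΛ : hexDomainSimplyConnected Λ)
    (ha : a ∈ hexDomainBoundary Λ) {v : HexVertex} (hv : v ∈ Λ) (hd : Deep Λ v R₀)
    {w w' : HexVertex} (hw : hexGraph.Adj v w) (hw' : hexGraph.Adj v w') :
    ‖obs Λ a s(v, w)‖ ≤ (1 + k) / (1 - k) * ‖obs Λ a s(v, w')‖ :=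
  norm_Fobs_le_of_adj hk0 hk1 (depthFlat_of_ratioAtDepth hR) hΛ ha hv hd hw hw'

/-- **`M = 0 ↔ the star vanishes`** at an `R₀`-deep vertex of `Λ`. -/
theorem fieldMono_obs_eq_zero_iff {k R₀ : ℝ} (hR : RatioAtDepth R₀ k) {Λ : Finset HexVertex}
    {a : Sym2 HexVertex} (hΛ : hexDomainSimplyConnected Λ) (ha : a ∈ hexDomainBoundary Λ)
    {v : HexVertex} (hv : v ∈ Λ) (hd : Deep Λ v R₀) {w₀ w₁ w₂ : HexVertex}
    (h₀ : hexGraph.Adj v w₀) (h₁ : hexGraph.Adj v w₁) (h₂ : hexGraph.Adj v w₂) (h01 : w₀ ≠ w₁)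
    (h12 : w₁ ≠ w₂) (h02 : w₀ ≠ w₂) :
    fieldMono (obs Λ a) v w₀ w₁ w₂ = 0 ↔
      obs Λ a s(v, w₀) = 0 ∧ obs Λ a s(v, w₁) = 0 ∧ obs Λ a s(v, w₂) = 0 :=
  mono_eq_zero_iff (depthFlat_of_ratioAtDepth hR) hΛ ha hv hd ⟨h₀, h₁, h₂, h01, h12, h02⟩

/-- **One dead edge kills the star**: if `F{v,w} = 0` for one neighbour `w` of an `R₀`-deep
`v ∈ Λ` (`k < 1`), the monopole at `v` vanishes in every frame. -/
theorem fieldMono_obs_eq_zero_of_obs_eq_zero {k R₀ : ℝ} (hk1 : k < 1) (hR : RatioAtDepth R₀ k)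
    {Λ : Finset HexVertex} {a : Sym2 HexVertex} (hΛ : hexDomainSimplyConnected Λ)
    (ha : a ∈ hexDomainBoundary Λ) {v : HexVertex} (hv : v ∈ Λ) (hd : Deep Λ v R₀)
    {w₀ w₁ w₂ : HexVertex} (h₀ : hexGraph.Adj v w₀) (h₁ : hexGraph.Adj v w₁)
    (h₂ : hexGraph.Adj v w₂) (h01 : w₀ ≠ w₁) (h12 : w₁ ≠ w₂) (h02 : w₀ ≠ w₂) {w : HexVertex}
    (hw : hexGraph.Adj v w) (h0 : obs Λ a s(v, w) = 0) : fieldMono (obs Λ a) v w₀ w₁ w₂ = 0 :=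
  mono_eq_zero_of_Fobs_eq_zero hk1 (depthFlat_of_ratioAtDepth hR) hΛ ha hv hd
    ⟨h₀, h₁, h₂, h01, h12, h02⟩ hw h0

/-! ### (c) Chains from the origin vertex -/

/-- **Explicit two-sided bounds at depth.** Under `RatioAtDepth R₀ k` (`0 ≤ k < 1`), for every
vertex `v` there is `m : ℕ` such that, whenever `O` is `n`-deep in a simply connected `Λ` with
boundary root `a` and `n ≥ dist(c_v, c_O) + max R₀ 0`, every edge `{v, w}` satisfies
`‖obs Λ a {v,w}‖ ≤ (1+k)/3 · K^(m+1) ‖obsMono Λ a‖` and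
`‖obsMono Λ a‖ ≤ 3/(1-k) · K^(m+1) ‖obs Λ a {v,w}‖`, `K = (1+k)/(1-k)`. -/
theorem obs_bounds_of_deep {k R₀ : ℝ} (hk0 : 0 ≤ k) (hk1 : k < 1) (hR : RatioAtDepth R₀ k)
    (v : HexVertex) :
    ∃ m : ℕ, ∀ (Λ : Finset HexVertex) (a : Sym2 HexVertex) (n : ℝ),
      dist (hexCenter v) (hexCenter O) + max R₀ 0 ≤ n → hexDomainSimplyConnected Λ →
      a ∈ hexDomainBoundary Λ → Deep Λ O n → ∀ w : HexVertex, hexGraph.Adj v w →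
        ‖obs Λ a s(v, w)‖ ≤ (1 + k) / 3 * ((1 + k) / (1 - k)) ^ (m + 1) * ‖obsMono Λ a‖ ∧
        ‖obsMono Λ a‖ ≤ 3 / (1 - k) * ((1 + k) / (1 - k)) ^ (m + 1) * ‖obs Λ a s(v, w)‖ :=
  bounds_of_deep hk0 hk1 (depthFlat_of_ratioAtDepth hR) isStar_O v

/-- **Edges are bounded by the monopole at `O`** (registered sub-goal of the crux; consumed by the
compactness stub S2 and the reduction S7). Under `RatioAtDepth R₀ k` (`0 ≤ k < 1`), for every
edge `z` there are `C, N` (depending on `z, k, R₀` only) such that `‖obs Λ a z‖ ≤ C ‖obsMono Λ a‖`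
for every simply connected `Λ` with boundary root `a` in which `O` is `N`-deep: `M(O)`-normalised
observables are bounded edge by edge (precompactness). -/
theorem obs_le_of_deep : ∀ (k R₀ : ℝ), 0 ≤ k → k < 1 → RatioAtDepth R₀ k →
    ∀ z ∈ hexGraph.edgeSet, ∃ C N : ℝ, ∀ (Λ : Finset HexVertex) (a : Sym2 HexVertex) (n : ℝ),
      N ≤ n → hexDomainSimplyConnected Λ → a ∈ hexDomainBoundary Λ → Deep Λ O n →
        ‖obs Λ a z‖ ≤ C * ‖obsMono Λ a‖ := by
  intro k R₀ hk0 hk1 hR z hz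
  exact Fobs_le_mono_of_deep k R₀ hk0 hk1 (depthFlat_of_ratioAtDepth hR) O nbA nbB nbC isStar_O z hz

/-- **The monopole at `O` is bounded by any edge** (the converse chain). Under `RatioAtDepth R₀ k`
(`0 ≤ k < 1`), for every edge `z` there are `C, N` (depending on `z, k, R₀` only) with
`‖obsMono Λ a‖ ≤ C ‖obs Λ a z‖` once `O` is `N`-deep: a normalised field that dies at one deep
edge is dead at the star of `O` ("alive or dead"). -/
theorem obsMono_le : ∀ (k R₀ : ℝ), 0 ≤ k → k < 1 → RatioAtDepth R₀ k →
    ∀ z ∈ hexGraph.edgeSet, ∃ C N : ℝ, ∀ (Λ : Finset HexVertex) (a : Sym2 HexVertex) (n : ℝ),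
      N ≤ n → hexDomainSimplyConnected Λ → a ∈ hexDomainBoundary Λ → Deep Λ O n →
        ‖obsMono Λ a‖ ≤ C * ‖obs Λ a z‖ := by
  intro k R₀ hk0 hk1 hR z hz
  exact mono_le_Fobs_of_deep k R₀ hk0 hk1 (depthFlat_of_ratioAtDepth hR) O nbA nbB nbC isStar_O z hz

/-- **Alive or dead, edge by edge**: once `O` is deep enough (depending on the edge `z`),
`obs Λ a z = 0 ↔ obsMono Λ a = 0`. -/
theorem obs_eq_zero_iff : ∀ (k R₀ : ℝ), 0 ≤ k → k < 1 → RatioAtDepth R₀ k →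
    ∀ z ∈ hexGraph.edgeSet, ∃ N : ℝ, ∀ (Λ : Finset HexVertex) (a : Sym2 HexVertex) (n : ℝ),
      N ≤ n → hexDomainSimplyConnected Λ → a ∈ hexDomainBoundary Λ → Deep Λ O n →
        (obs Λ a z = 0 ↔ obsMono Λ a = 0) := by
  intro k R₀ hk0 hk1 hR z hz
  obtain ⟨C, N, h⟩ := obs_le_of_deep k R₀ hk0 hk1 hR z hz
  obtain ⟨C', N', h'⟩ := obsMono_le k R₀ hk0 hk1 hR z hz
  refine ⟨max N N', fun Λ a n hn hΛ ha hd => ⟨fun h0 => ?_, fun h0 => ?_⟩⟩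
  · have := h' Λ a n (le_trans (le_max_right _ _) hn) hΛ ha hd
    rw [h0, norm_zero, mul_zero] at this
    exact norm_eq_zero.1 (le_antisymm this (norm_nonneg _))
  · have := h Λ a n (le_trans (le_max_left _ _) hn) hΛ ha hd
    rw [h0, norm_zero, mul_zero] at this
    exact norm_eq_zero.1 (le_antisymm this (norm_nonneg _))

/-! ### Uniform versions over the comparison set `innerEdges r` -/

/-- Unfolding membership in `innerEdges r`: an edge with both endpoints in `B_r(O)`. -/
theorem mem_innerEdges {r : ℝ} {e : Sym2 HexVertex} (he : e ∈ innerEdges r) :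
    ∃ v w : HexVertex, hexGraph.Adj v w ∧ dist (hexCenter v) (hexCenter O) ≤ r ∧
      dist (hexCenter w) (hexCenter O) ≤ r ∧ e = s(v, w) := by
  unfold innerEdges at he
  rw [Finset.mem_image] at he
  obtain ⟨⟨v, w⟩, hp, rfl⟩ := he
  rw [Finset.mem_filter, Finset.mem_product] at hp
  exact ⟨v, w, hp.2, mem_latticeBall_iff.1 hp.1.1, mem_latticeBall_iff.1 hp.1.2, rfl⟩

/-- **Edges of `B_r(O)` are UNIFORMLY bounded by the monopole at `O`.** Under `RatioAtDepth R₀ k`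
(`0 ≤ k < 1`), for every radius `r` there are `C, N` (depending on `r, k, R₀` only) such that
`‖obs Λ a e‖ ≤ C ‖obsMono Λ a‖` for all `e ∈ innerEdges r`, every simply connected `Λ` with
boundary root `a`, once `O` is `N`-deep (`N = r + max R₀ 0` works). -/
theorem obs_le_of_deep_inner : ∀ (k R₀ : ℝ), 0 ≤ k → k < 1 → RatioAtDepth R₀ k → ∀ r : ℝ,
    ∃ C N : ℝ, ∀ (Λ : Finset HexVertex) (a : Sym2 HexVertex) (n : ℝ), N ≤ n →
      hexDomainSimplyConnected Λ → a ∈ hexDomainBoundary Λ → Deep Λ O n →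
        ∀ e ∈ innerEdges r, ‖obs Λ a e‖ ≤ C * ‖obsMono Λ a‖ := by
  intro k R₀ hk0 hk1 hR r
  choose m hm using fun v => obs_bounds_of_deep hk0 hk1 hR v
  set Mtot : ℕ := ∑ v ∈ latticeBall r, (m v + 1)
  refine ⟨(1 + k) / 3 * ((1 + k) / (1 - k)) ^ Mtot, r + max R₀ 0,
    fun Λ a n hn hΛ ha hd e he => ?_⟩
  obtain ⟨v, w, hvw, hv, -, rfl⟩ := mem_innerEdges he
  have hle : dist (hexCenter v) (hexCenter O) + max R₀ 0 ≤ n := by linarith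
  have h1 := (hm v Λ a n hle hΛ ha hd w hvw).1
  have hmv : m v + 1 ≤ Mtot :=
    Finset.single_le_sum (f := fun v => m v + 1) (fun _ _ => Nat.zero_le _) (mem_latticeBall_iff.2 hv)
  have hpow : ((1 + k) / (1 - k)) ^ (m v + 1) ≤ ((1 + k) / (1 - k)) ^ Mtot :=
    pow_le_pow_right₀ (by rw [le_div_iff₀ (by linarith : (0 : ℝ) < 1 - k)]; linarith) hmv
  have hc : 0 ≤ (1 + k) / 3 * ‖obsMono Λ a‖ := by positivity
  calc ‖obs Λ a s(v, w)‖ ≤ (1 + k) / 3 * ((1 + k) / (1 - k)) ^ (m v + 1) * ‖obsMono Λ a‖ := h1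
    _ = ((1 + k) / (1 - k)) ^ (m v + 1) * ((1 + k) / 3 * ‖obsMono Λ a‖) := by ring
    _ ≤ ((1 + k) / (1 - k)) ^ Mtot * ((1 + k) / 3 * ‖obsMono Λ a‖) :=
      mul_le_mul_of_nonneg_right hpow hc
    _ = (1 + k) / 3 * ((1 + k) / (1 - k)) ^ Mtot * ‖obsMono Λ a‖ := by ring

/-- **The monopole at `O` is UNIFORMLY bounded by every edge of `B_r(O)`** (converse chain).
Under `RatioAtDepth R₀ k` (`0 ≤ k < 1`), for every `r` there are `C, N` (depending on `r, k, R₀`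
only) with `‖obsMono Λ a‖ ≤ C ‖obs Λ a e‖` for all `e ∈ innerEdges r` once `O` is `N`-deep. -/
theorem obsMono_le_inner : ∀ (k R₀ : ℝ), 0 ≤ k → k < 1 → RatioAtDepth R₀ k → ∀ r : ℝ,
    ∃ C N : ℝ, ∀ (Λ : Finset HexVertex) (a : Sym2 HexVertex) (n : ℝ), N ≤ n →
      hexDomainSimplyConnected Λ → a ∈ hexDomainBoundary Λ → Deep Λ O n →
        ∀ e ∈ innerEdges r, ‖obsMono Λ a‖ ≤ C * ‖obs Λ a e‖ := by
  intro k R₀ hk0 hk1 hR r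
  choose m hm using fun v => obs_bounds_of_deep hk0 hk1 hR v
  set Mtot : ℕ := ∑ v ∈ latticeBall r, (m v + 1)
  have h1k : 0 < 1 - k := by linarith
  refine ⟨3 / (1 - k) * ((1 + k) / (1 - k)) ^ Mtot, r + max R₀ 0,
    fun Λ a n hn hΛ ha hd e he => ?_⟩
  obtain ⟨v, w, hvw, hv, -, rfl⟩ := mem_innerEdges he
  have hle : dist (hexCenter v) (hexCenter O) + max R₀ 0 ≤ n := by linarith
  have h2 := (hm v Λ a n hle hΛ ha hd w hvw).2
  have hmv : m v + 1 ≤ Mtot :=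
    Finset.single_le_sum (f := fun v => m v + 1) (fun _ _ => Nat.zero_le _) (mem_latticeBall_iff.2 hv)
  have hpow : ((1 + k) / (1 - k)) ^ (m v + 1) ≤ ((1 + k) / (1 - k)) ^ Mtot :=
    pow_le_pow_right₀ (by rw [le_div_iff₀ (by linarith : (0 : ℝ) < 1 - k)]; linarith) hmv
  have hc : 0 ≤ 3 / (1 - k) * ‖obs Λ a s(v, w)‖ :=
    mul_nonneg (div_nonneg (by norm_num) h1k.le) (norm_nonneg _)
  calc ‖obsMono Λ a‖ ≤ 3 / (1 - k) * ((1 + k) / (1 - k)) ^ (m v + 1) * ‖obs Λ a s(v, w)‖ := h2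
    _ = ((1 + k) / (1 - k)) ^ (m v + 1) * (3 / (1 - k) * ‖obs Λ a s(v, w)‖) := by ring
    _ ≤ ((1 + k) / (1 - k)) ^ Mtot * (3 / (1 - k) * ‖obs Λ a s(v, w)‖) :=
      mul_le_mul_of_nonneg_right hpow hc
    _ = 3 / (1 - k) * ((1 + k) / (1 - k)) ^ Mtot * ‖obs Λ a s(v, w)‖ := by ring

/-- **Alive or dead on `B_r(O)`**: once `O` is deep enough (depending on `r, k, R₀` only), the
observable vanishes at an edge of `innerEdges r` iff its monopole at `O` vanishes — so it is
either nowhere zero or identically zero on `innerEdges r`. -/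
theorem obs_eq_zero_iff_inner : ∀ (k R₀ : ℝ), 0 ≤ k → k < 1 → RatioAtDepth R₀ k → ∀ r : ℝ,
    ∃ N : ℝ, ∀ (Λ : Finset HexVertex) (a : Sym2 HexVertex) (n : ℝ), N ≤ n →
      hexDomainSimplyConnected Λ → a ∈ hexDomainBoundary Λ → Deep Λ O n →
        ∀ e ∈ innerEdges r, (obs Λ a e = 0 ↔ obsMono Λ a = 0) := by
  intro k R₀ hk0 hk1 hR r
  obtain ⟨C, N, h⟩ := obs_le_of_deep_inner k R₀ hk0 hk1 hR r
  obtain ⟨C', N', h'⟩ := obsMono_le_inner k R₀ hk0 hk1 hR r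
  refine ⟨max N N', fun Λ a n hn hΛ ha hd e he => ⟨fun h0 => ?_, fun h0 => ?_⟩⟩
  · have := h' Λ a n (le_trans (le_max_right _ _) hn) hΛ ha hd e he
    rw [h0, norm_zero, mul_zero] at this
    exact norm_eq_zero.1 (le_antisymm this (norm_nonneg _))
  · have := h Λ a n (le_trans (le_max_left _ _) hn) hΛ ha hd e he
    rw [h0, norm_zero, mul_zero] at this
    exact norm_eq_zero.1 (le_antisymm this (norm_nonneg _))

/-! ### Picture domains (the rows of the reduction S7) -/

/-- **Harnack in picture domains.** For the field `picField S P = obs (B_S(O) ∖ P.1) (picRoot P)`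
of a picture domain that is simply connected, rooted at a boundary dart, with `O` `N`-deep
(e.g. a good `s̄`-clean picture, `s̄ ≥ N`): `‖picField S P e‖ ≤ C ‖picMono S P‖` on
`innerEdges r`, with the constants of `obs_le_of_deep_inner`. -/
theorem picField_le_inner : ∀ (k R₀ : ℝ), 0 ≤ k → k < 1 → RatioAtDepth R₀ k → ∀ r : ℝ,
    ∃ C N : ℝ, ∀ (S : ℝ) (P : Picture) (n : ℝ), N ≤ n →
      hexDomainSimplyConnected (latticeBall S \ P.1) →
      picRoot P ∈ hexDomainBoundary (latticeBall S \ P.1) → Deep (latticeBall S \ P.1) O n →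
        ∀ e ∈ innerEdges r, ‖picField S P e‖ ≤ C * ‖picMono S P‖ := by
  intro k R₀ hk0 hk1 hR r
  obtain ⟨C, N, h⟩ := obs_le_of_deep_inner k R₀ hk0 hk1 hR r
  exact ⟨C, N, fun S P n hn hΛ ha hd e he => h _ _ n hn hΛ ha hd e he⟩

/-- **Alive or dead rows.** In the same situation `‖picMono S P‖ ≤ C ‖picField S P e‖` on
`innerEdges r`: a row whose monopole at `O` vanishes is dead on `innerEdges r`, and conversely. -/
theorem picMono_le_inner : ∀ (k R₀ : ℝ), 0 ≤ k → k < 1 → RatioAtDepth R₀ k → ∀ r : ℝ,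
    ∃ C N : ℝ, ∀ (S : ℝ) (P : Picture) (n : ℝ), N ≤ n →
      hexDomainSimplyConnected (latticeBall S \ P.1) →
      picRoot P ∈ hexDomainBoundary (latticeBall S \ P.1) → Deep (latticeBall S \ P.1) O n →
        ∀ e ∈ innerEdges r, ‖picMono S P‖ ≤ C * ‖picField S P e‖ := by
  intro k R₀ hk0 hk1 hR r
  obtain ⟨C, N, h⟩ := obsMono_le_inner k R₀ hk0 hk1 hR r
  exact ⟨C, N, fun S P n hn hΛ ha hd e he => h _ _ n hn hΛ ha hd e he⟩

end Summit.CriticalPhenomena.SAWScalingLimit.Theorems.InteriorFlattening.Liouville.Harnack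

end
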